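import Mathlib

/-!
# Solo-blind seat (MatrixMultiplication), s65 — THEOREM T△² (the doubled case of Conjecture T△; SHARPEST §2T, TRIANGLE.md (R8), CLAIMS c616)

Door I1⁗ (character-averaged rank-3 deformations of `cw₂ ≅ T_xyz`, CW90 §11 generalised) reduces to the
combinatorial quantity `h(n) = min |H|` over finite abelian groups `H` carrying a GOOD family of `n` zero-sum
triangles `{a_i, b_i, c_i}` (`a_i + b_i + c_i = 0`): no non-empty RAINBOW selection (at most one element per
triangle) sums to `0`.  Conjecture T△ (this seat): `|H| ≥ 3^{n/2}`.

This file proves it for DOUBLED families (every triangle used exactly twice, `n = 2d`): the `3^d` sums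
`Σ_i e_i`, `e_i ∈ E_i := {0, a_i, -b_i}`, are pairwise distinct — because every difference
`E_i - E_i ⊆ {0, ±a_i, ±b_i, ±c_i}` is itself a rainbow selection from the two copies of triangle `i`
(`-a = b + c`, `-b = a + c`, `-c = a + b`) — and each of them is a rainbow sum.  Hence `|U| ≥ 3^d` for the set
`U` of rainbow sums and `|H| ≥ 3^d = 3^{n/2}`, with equality for the 3-adic families
`{3^j, 3^j, -2·3^j}²` in `ℤ/3^k`.  Selections from the two copies are encoded by two maps
`s t : Fin d → Option (Fin 3)` (`none` = nothing chosen from that copy).  No `ω` content by itself.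
-/

namespace Summit.MatrixMultiplication.MatrixMultiplication.Theorems

open Finset BigOperators

section TriangleDoubled

variable {H : Type*} [AddCommGroup H] {d : ℕ}

/-- Value of a (possibly empty) choice from triangle `i`: `none ↦ 0`, `some 0 ↦ a i`, `some 1 ↦ b i`,
`some 2 ↦ c i`. -/
def soloBlindTriVal (a b c : Fin d → H) (i : Fin d) (o : Option (Fin 3)) : H :=
  o.elim 0 ![a i, b i, c i]

/-- The packing set `E_i = {0, a_i, -b_i}` indexed by `Fin 3`. -/
def soloBlindTriE (a b : Fin d → H) (i : Fin d) (x : Fin 3) : H :=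
  ![0, a i, -(b i)] x

/-- The representation table: `E_i x - E_i y` as a rainbow selection `(first copy, second copy)` from the two
copies of triangle `i`; the diagonal is the empty selection. -/
def soloBlindTriRep (x y : Fin 3) : Option (Fin 3) × Option (Fin 3) :=
  ![![((none : Option (Fin 3)), (none : Option (Fin 3))), (some 1, some 2), (some 1, none)],
    ![(some 0, none), (none, none), (some 0, some 1)],
    ![(some 0, some 2), (some 2, none), (none, none)]] x y

omit [AddCommGroup H] in
/-- Off the diagonal the table entry is a non-empty selection. -/
theorem soloBlind_triRep_eq_of_none (x y : Fin 3)
    (h1 : (soloBlindTriRep x y).1 = none) (h2 : (soloBlindTriRep x y).2 = none) : x = y := by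
  fin_cases x <;> fin_cases y <;> simp_all [soloBlindTriRep]

/-- The table is correct: its value is `E_i x - E_i y` (uses only `a_i + b_i + c_i = 0`). -/
theorem soloBlind_triRep_val (a b c : Fin d → H) (hsum : ∀ i, a i + b i + c i = 0) (i : Fin d)
    (x y : Fin 3) :
    soloBlindTriVal a b c i (soloBlindTriRep x y).1 + soloBlindTriVal a b c i (soloBlindTriRep x y).2
      = soloBlindTriE a b i x - soloBlindTriE a b i y := by
  have hc : c i = -(a i) - b i := by
    have h : c i = -(a i + b i) := eq_neg_of_add_eq_zero_right (hsum i)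
    rw [h]; abel
  fin_cases x <;> fin_cases y <;> simp [soloBlindTriRep, soloBlindTriVal, soloBlindTriE, hc] <;> abel

/-- Every element of `E_1 + ⋯ + E_d` is a rainbow sum of the doubled family:
`0 = ∅`, `a_i = a_i`, `-b_i = a_i + c_i` (one element from each copy). -/
def soloBlindTriSel (x : Fin 3) : Option (Fin 3) × Option (Fin 3) :=
  ![((none : Option (Fin 3)), (none : Option (Fin 3))), (some 0, none), (some 0, some 2)] x

/-- The selection table `soloBlindTriSel` is correct: its value is `E_i x` (uses only `a_i + b_i + c_i = 0`). -/
theorem soloBlind_triSel_val (a b c : Fin d → H) (hsum : ∀ i, a i + b i + c i = 0) (i : Fin d)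
    (x : Fin 3) :
    soloBlindTriVal a b c i (soloBlindTriSel x).1 + soloBlindTriVal a b c i (soloBlindTriSel x).2
      = soloBlindTriE a b i x := by
  have hc : c i = -(a i) - b i := by
    have h : c i = -(a i + b i) := eq_neg_of_add_eq_zero_right (hsum i)
    rw [h]; abel
  fin_cases x <;> (simp [soloBlindTriSel, soloBlindTriVal, soloBlindTriE, hc]; try abel)

/-- Three copies of one triangle are never good: `a_i + b_i + c_i = 0` is a rainbow zero-sum across three
copies (so a good family has multiplicities `≤ 2`: it is `d` doubled plus `s` simple triangles). -/
theorem soloBlind_triangle_three_copies (a b c : Fin d → H) (hsum : ∀ i, a i + b i + c i = 0) (i : Fin d) :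
    soloBlindTriVal a b c i (some 0) + soloBlindTriVal a b c i (some 1) + soloBlindTriVal a b c i (some 2)
      = 0 := by
  simpa [soloBlindTriVal] using hsum i

/-- **THEOREM T△² (injectivity).**  If the doubled family `{a_i,b_i,c_i}` (each twice, `i < d`) is good —
every selection `s` from the first copies and `t` from the second copies with total `0` is empty — then
`f ↦ Σ_i E_i (f i)` is injective on `Fin d → Fin 3`. -/
theorem soloBlind_triangleDoubled_injective (a b c : Fin d → H) (hsum : ∀ i, a i + b i + c i = 0)
    (hgood : ∀ s t : Fin d → Option (Fin 3),
      (∑ i, (soloBlindTriVal a b c i (s i) + soloBlindTriVal a b c i (t i))) = 0 →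
        ∀ i, s i = none ∧ t i = none) :
    Function.Injective (fun f : Fin d → Fin 3 => ∑ i, soloBlindTriE a b i (f i)) := by
  intro f g hfg
  simp only at hfg
  have key := hgood (fun i => (soloBlindTriRep (f i) (g i)).1)
    (fun i => (soloBlindTriRep (f i) (g i)).2) (by
      simp only [soloBlind_triRep_val a b c hsum]
      rw [Finset.sum_sub_distrib, hfg, sub_self])
  funext i
  exact soloBlind_triRep_eq_of_none (f i) (g i) (key i).1 (key i).2

/-- **THEOREM T△² (group order).**  A good doubled family of `n = 2d` zero-sum triangles forces
`|H| ≥ 3^d = 3^{n/2}` — Conjecture T△ on the doubled class (tight: `{3^j,3^j,-2·3^j}²`, `j < k`, in `ℤ/3^k`). -/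
theorem soloBlind_triangleDoubled_card [Fintype H] (a b c : Fin d → H)
    (hsum : ∀ i, a i + b i + c i = 0)
    (hgood : ∀ s t : Fin d → Option (Fin 3),
      (∑ i, (soloBlindTriVal a b c i (s i) + soloBlindTriVal a b c i (t i))) = 0 →
        ∀ i, s i = none ∧ t i = none) :
    3 ^ d ≤ Fintype.card H := by
  have h := Fintype.card_le_of_injective _ (soloBlind_triangleDoubled_injective a b c hsum hgood)
  simpa [Fintype.card_fun, Fintype.card_fin] using h

/-- **THEOREM T△² (rainbow sums).**  Under the same hypothesis the set `U` of rainbow sums of the doubled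
family (values `Σ_i (val (s i) + val (t i))` over all selections) has at least `3^d` elements: the strong
form of Conjecture T△ on the doubled class. -/
theorem soloBlind_triangleDoubled_card_rainbowSums [DecidableEq H] (a b c : Fin d → H)
    (hsum : ∀ i, a i + b i + c i = 0)
    (hgood : ∀ s t : Fin d → Option (Fin 3),
      (∑ i, (soloBlindTriVal a b c i (s i) + soloBlindTriVal a b c i (t i))) = 0 →
        ∀ i, s i = none ∧ t i = none) :
    3 ^ d ≤ (Finset.univ.image (fun st : (Fin d → Option (Fin 3)) × (Fin d → Option (Fin 3)) =>
        ∑ i, (soloBlindTriVal a b c i (st.1 i) + soloBlindTriVal a b c i (st.2 i)))).card := by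
  classical
  set e : (Fin d → Fin 3) → H := fun f => ∑ i, soloBlindTriE a b i (f i) with he
  have hinj : Function.Injective e := soloBlind_triangleDoubled_injective a b c hsum hgood
  have hcard : (Finset.univ.image e).card = 3 ^ d := by
    rw [Finset.card_image_of_injective _ hinj]
    simp [Fintype.card_fin]
  rw [← hcard]
  apply Finset.card_le_card
  intro u hu
  rw [Finset.mem_image] at hu ⊢
  obtain ⟨f, -, rfl⟩ := hu
  refine ⟨(fun i => (soloBlindTriSel (f i)).1, fun i => (soloBlindTriSel (f i)).2), Finset.mem_univ _, ?_⟩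
  simp only [he, soloBlind_triSel_val a b c hsum]

end TriangleDoubled

end Summit.MatrixMultiplication.MatrixMultiplication.Theorems
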